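import Literature.Combinatorics.SetFamily.CubeMiddleLayer
import Mathlib.Analysis.SpecialFunctions.Pow.Real
import Mathlib.Analysis.SpecialFunctions.Sqrt
import Mathlib.Data.Nat.Choose.Central
import Literature.Barriers.CriticalPhenomena.PlanarEdwardsModelDiffusiveProofs
import HarnessLib

/-!
# Subcubes over `(A choose d)`: the union is half the cube, the middle layer is a `1/(2√k)` fraction of it

Continuation of `CubeMiddleLayer.lean`. Binomial-sum bookkeeping for the union `U = {wt_A ≥ d}` and the
layer `B = {wt_A = d}` (`|A| = a`):

* `two_mul_sum_choose_ge`: `2·Σ_{w=d}^{a} C(a,w) ≥ 2^a` when `2d ≤ a`; hence `card_Uset_ge : |U| ≥ 2^{n-1}`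
  (the union covers half the cube);
* the ratio `λ = |B|/|U| = C(a,d)/Σ_{w=d}^{a} C(a,w)` cleared of denominators (`lambda_eq`, `lambda_ge`), and for
  the middle layer `d = k`, `a = 2k`: `2·Σ_{w=k}^{2k} C(2k,w) = 4^k + C(2k,k)` (`two_mul_sum_choose_kk`, `lambda_kk`);
* the central-binomial bound `16^k ≤ 4k·C(2k,k)²` (the tree's
  `Literature.Barriers.CriticalPhenomena.Edwards2D.sixteen_pow_le_mul_centralBinom_sq`, i.e. `C(2k,k) ≥ 4^k/(2√k)`), whence
  `two_pow_le_sqrt_mul_Bset : 2^n ≤ 2√k·|B|` and `card_Uset_le_sqrt : |U| ≤ 2√k·|B|`: deleting the middle layer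
  costs the union at least a `1/(2√k)` fraction — against exactly `2^{-k}` per member (`CubeMiddleLayerLoss`).

-- adapted from reserve/prior-2001/Prior/PneNP/PneNP/Pnp_Y3DaglikeReslinWidthAndLayerCounting_MiddleLayerCounterexample.lean
-- (internal 2001 programme, route y3, manuscript "The middle layer of the cube refutes a union-stability
-- conjecture for affine subspaces", v2 6c855445, 2026-08; unpublished, NOT cited as a source anywhere in
-- the tree); proofs unchanged, namespace and docstrings adapted.
-/

namespace Literature.Combinatorics.SetFamily

open Finset

namespace CubeMiddleLayer

variable {n : ℕ}

/-! ### Binomial sums: reflection, the half bound, and the `d = k` closed form -/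

/-- Reflection of a binomial tail: `Σ_{w=d}^{a} C(a,w) = Σ_{w=0}^{a-d} C(a,w)`. [folklore] -/
lemma sum_Icc_choose_reflect (d a : ℕ) (hda : d ≤ a) :
    ∑ w ∈ Finset.Icc d a, a.choose w = ∑ w ∈ Finset.Icc 0 (a - d), a.choose w := by
  apply Finset.sum_nbij' (i := fun w => a - w) (j := fun w => a - w)
  · intro w hw
    simp only [Finset.mem_Icc] at hw ⊢
    omega
  · intro w hw
    simp only [Finset.mem_Icc] at hw ⊢
    omega
  · intro w hw
    simp only [Finset.mem_Icc] at hw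
    omega
  · intro w hw
    simp only [Finset.mem_Icc] at hw
    omega
  · intro w hw
    simp only [Finset.mem_Icc] at hw
    exact (Nat.choose_symm hw.2).symm

/-- `[0, a] = range (a+1)`. [folklore] -/
lemma Icc_zero_eq_range (a : ℕ) : Finset.Icc 0 a = Finset.range (a + 1) := by
  ext w
  simp only [Finset.mem_Icc, Finset.mem_range]
  omega

/-- `2 · Σ_{d ≤ w ≤ a} C(a,w) ≥ 2^a` whenever `2d ≤ a` (half of the binomial row). [folklore] -/
lemma two_mul_sum_choose_ge (d a : ℕ) (h2d : 2 * d ≤ a) :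
    2 ^ a ≤ 2 * ∑ w ∈ Finset.Icc d a, a.choose w := by
  have hda : d ≤ a := by omega
  have hrefl := sum_Icc_choose_reflect d a hda
  have hsplit : ∑ w ∈ Finset.Icc 0 a, a.choose w
      = ∑ w ∈ Finset.Icc 0 (a - d), a.choose w
        + ∑ w ∈ Finset.Icc (a - d + 1) a, a.choose w := by
    rw [← Finset.sum_union ?hdisj]
    · congr 1
      ext w
      simp only [Finset.mem_union, Finset.mem_Icc]
      omega
    case hdisj =>
      rw [Finset.disjoint_left]
      intro w hw1 hw2
      simp only [Finset.mem_Icc] at hw1 hw2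
      omega
  have hsub : ∑ w ∈ Finset.Icc (a - d + 1) a, a.choose w
      ≤ ∑ w ∈ Finset.Icc d a, a.choose w := by
    apply Finset.sum_le_sum_of_subset
    intro w hw
    simp only [Finset.mem_Icc] at hw ⊢
    omega
  have htotal : ∑ w ∈ Finset.Icc 0 a, a.choose w = 2 ^ a := by
    rw [Icc_zero_eq_range]
    exact Nat.sum_range_choose a
  omega

/-- `|U| ≥ 2^(n-1)`: the union covers at least half the cube when `|A| = d + k`, `d ≤ k`. [folklore] -/
theorem card_Uset_ge (A : Finset (Fin n)) (d k : ℕ) (hA : A.card = d + k) (hdk : d ≤ k)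
    (hn : 1 ≤ n) :
    2 ^ (n - 1) ≤ (Uset A d).card := by
  have han : A.card ≤ n := card_le_univ_n A
  have hsum := two_mul_sum_choose_ge d A.card (by omega)
  have hcard := card_Uset A d
  have h2 : 2 * (Uset A d).card
      = (2 * ∑ w ∈ Finset.Icc d A.card, A.card.choose w) * 2 ^ (n - A.card) := by
    rw [hcard]; ring
  have hge : 2 ^ A.card * 2 ^ (n - A.card) ≤ 2 * (Uset A d).card := by
    rw [h2]
    exact Nat.mul_le_mul_right _ hsum
  rw [← pow_add] at hge
  have he : A.card + (n - A.card) = n := by omega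
  rw [he] at hge
  have h2n : 2 * 2 ^ (n - 1) = 2 ^ n := by
    rw [← pow_succ']
    congr 1
    omega
  omega

/-- The loss identity, cleared of denominators:
`|B| · Σ_{d ≤ w ≤ a} C(a,w) = C(a,d) · |U|`, i.e. `λ = C(a,d)/Σ_{w=d}^{a} C(a,w)`. [folklore] -/
theorem lambda_eq (A : Finset (Fin n)) (d : ℕ) :
    (Bset A d).card * (∑ w ∈ Finset.Icc d A.card, A.card.choose w)
      = A.card.choose d * (Uset A d).card := by
  rw [card_Bset, card_Uset]
  ring

/-- The loss lower bound, cleared of denominators: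
`C(a,d) · |U| ≤ 2^a · |B|`, i.e. `λ ≥ C(a,d) · 2^{-a} = C(d+k,d) 2^{-d-k}`. [folklore] -/
theorem lambda_ge (A : Finset (Fin n)) (d : ℕ) :
    A.card.choose d * (Uset A d).card ≤ 2 ^ A.card * (Bset A d).card := by
  have han : A.card ≤ n := card_le_univ_n A
  have hU : (Uset A d).card ≤ 2 ^ n := by
    calc (Uset A d).card ≤ (Finset.univ : Finset (V n)).card := Finset.card_le_univ _
    _ = 2 ^ n := card_univ_V
  calc A.card.choose d * (Uset A d).card
      ≤ A.card.choose d * 2 ^ n := Nat.mul_le_mul_left _ hU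
  _ = A.card.choose d * (2 ^ A.card * 2 ^ (n - A.card)) := by
      rw [← pow_add]
      congr 2
      omega
  _ = 2 ^ A.card * (A.card.choose d * 2 ^ (n - A.card)) := by ring
  _ = 2 ^ A.card * (Bset A d).card := by rw [card_Bset]

/-- `2 · Σ_{k ≤ w ≤ 2k} C(2k,w) = 4^k + C(2k,k)` (middle-layer identity, `d = k`). [folklore] -/
lemma two_mul_sum_choose_kk (k : ℕ) :
    2 * ∑ w ∈ Finset.Icc k (2 * k), (2 * k).choose w = 2 ^ (2 * k) + (2 * k).choose k := by
  have hrefl := sum_Icc_choose_reflect k (2 * k) (by omega)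
  have he : 2 * k - k = k := by omega
  rw [he] at hrefl
  have hsplit : ∑ w ∈ Finset.Icc 0 (2 * k), (2 * k).choose w
      = ∑ w ∈ Finset.Icc 0 k, (2 * k).choose w
        + ∑ w ∈ Finset.Icc (k + 1) (2 * k), (2 * k).choose w := by
    rw [← Finset.sum_union ?hdisj]
    · congr 1
      ext w
      simp only [Finset.mem_union, Finset.mem_Icc]
      omega
    case hdisj =>
      rw [Finset.disjoint_left]
      intro w hw1 hw2
      simp only [Finset.mem_Icc] at hw1 hw2
      omega
  have htotal : ∑ w ∈ Finset.Icc 0 (2 * k), (2 * k).choose w = 2 ^ (2 * k) := by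
    rw [Icc_zero_eq_range]
    exact Nat.sum_range_choose (2 * k)
  have hinsert : Finset.Icc k (2 * k) = insert k (Finset.Icc (k + 1) (2 * k)) := by
    ext w
    simp only [Finset.mem_insert, Finset.mem_Icc]
    omega
  have hknot : k ∉ Finset.Icc (k + 1) (2 * k) := by
    simp only [Finset.mem_Icc]
    omega
  have hsum : ∑ w ∈ Finset.Icc k (2 * k), (2 * k).choose w
      = (2 * k).choose k + ∑ w ∈ Finset.Icc (k + 1) (2 * k), (2 * k).choose w := by
    rw [hinsert, Finset.sum_insert hknot]
  omega

/-- The `d = k` (middle-layer) loss identity, cleared of denominators: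
`|B| · (4^k + C(2k,k)) = 2·C(2k,k) · |U|`, i.e. `λ = 2C(2k,k)/(4^k + C(2k,k))`. [folklore] -/
theorem lambda_kk (A : Finset (Fin n)) (k : ℕ) (hA : A.card = 2 * k) :
    (Bset A k).card * (2 ^ (2 * k) + (2 * k).choose k)
      = 2 * (2 * k).choose k * (Uset A k).card := by
  have hB := card_Bset A k
  have hU := card_Uset A k
  rw [hA] at hB hU
  rw [hB, hU, ← two_mul_sum_choose_kk k]
  ring

/-- `2^n ≤ 2√k · |B|` for the `d = k` family: the removed layer carries at least a
`1/(2√k)` fraction of the whole cube. [folklore] -/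
theorem two_pow_le_sqrt_mul_Bset (A : Finset (Fin n)) (k : ℕ) (hA : A.card = 2 * k)
    (hk : 1 ≤ k) :
    (2 : ℝ) ^ n ≤ 2 * Real.sqrt k * ((Bset A k).card : ℝ) := by
  have han : A.card ≤ n := card_le_univ_n A
  have h2kn : 2 * k ≤ n := hA ▸ han
  have hB : (Bset A k).card = (2 * k).choose k * 2 ^ (n - 2 * k) := by
    have := card_Bset A k
    rwa [hA] at this
  have hC : Nat.centralBinom k = (2 * k).choose k := Nat.centralBinom_eq_two_mul_choose k
  -- (4:ℝ)^k ≤ 2√k · C(2k,k)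
  have hsq : (16 : ℝ) ^ k ≤ 4 * (k : ℝ) * ((2 * k).choose k : ℝ) ^ 2 := by
    have := Literature.Barriers.CriticalPhenomena.Edwards2D.sixteen_pow_le_mul_centralBinom_sq k hk
    rw [hC] at this
    exact_mod_cast this
  have hkR : (0 : ℝ) ≤ (k : ℝ) := Nat.cast_nonneg k
  have hCR : (0 : ℝ) ≤ ((2 * k).choose k : ℝ) := Nat.cast_nonneg _
  have hkey : (4 : ℝ) ^ k ≤ 2 * Real.sqrt k * ((2 * k).choose k : ℝ) := by
    have h1 : (4 : ℝ) ^ k = Real.sqrt ((16 : ℝ) ^ k) := by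
      rw [show (16 : ℝ) ^ k = ((4 : ℝ) ^ k) ^ 2 by
          rw [← pow_mul, mul_comm k 2, pow_mul]; norm_num,
        Real.sqrt_sq (by positivity)]
    have h2 : Real.sqrt (4 * (k : ℝ) * ((2 * k).choose k : ℝ) ^ 2)
        = 2 * Real.sqrt k * ((2 * k).choose k : ℝ) := by
      rw [show (4 : ℝ) * (k : ℝ) * ((2 * k).choose k : ℝ) ^ 2
          = (2 * Real.sqrt k * ((2 * k).choose k : ℝ)) ^ 2 by
        have : Real.sqrt k ^ 2 = (k : ℝ) := Real.sq_sqrt hkR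
        nlinarith [this]]
      exact Real.sqrt_sq (by positivity)
    rw [h1, ← h2]
    exact Real.sqrt_le_sqrt hsq
  calc (2 : ℝ) ^ n = (2 : ℝ) ^ (2 * k) * (2 : ℝ) ^ (n - 2 * k) := by
        rw [← pow_add]
        congr 1
        omega
  _ = (4 : ℝ) ^ k * (2 : ℝ) ^ (n - 2 * k) := by
        rw [show (2 : ℝ) ^ (2 * k) = (4 : ℝ) ^ k by rw [pow_mul]; norm_num]
  _ ≤ (2 * Real.sqrt k * ((2 * k).choose k : ℝ)) * (2 : ℝ) ^ (n - 2 * k) := by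
        apply mul_le_mul_of_nonneg_right hkey (by positivity)
  _ = 2 * Real.sqrt k * (((2 * k).choose k : ℝ) * (2 : ℝ) ^ (n - 2 * k)) := by ring
  _ = 2 * Real.sqrt k * ((Bset A k).card : ℝ) := by
        rw [hB]
        push_cast
        ring

/-- `|U| ≤ 2√k · |B|`: the union loses at least a `1/(2√k)` fraction
(`λ = |B|/|U| ≥ 1/(2√k)`, cleared of denominators). [folklore] -/
theorem card_Uset_le_sqrt (A : Finset (Fin n)) (k : ℕ) (hA : A.card = 2 * k) (hk : 1 ≤ k) :
    ((Uset A k).card : ℝ) ≤ 2 * Real.sqrt k * ((Bset A k).card : ℝ) := by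
  have hU : (Uset A k).card ≤ 2 ^ n := by
    calc (Uset A k).card ≤ (Finset.univ : Finset (V n)).card := Finset.card_le_univ _
    _ = 2 ^ n := card_univ_V
  calc ((Uset A k).card : ℝ) ≤ (2 : ℝ) ^ n := by exact_mod_cast hU
  _ ≤ 2 * Real.sqrt k * ((Bset A k).card : ℝ) := two_pow_le_sqrt_mul_Bset A k hA hk

end CubeMiddleLayer

end Literature.Combinatorics.SetFamily
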